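import Literature.AlgebraicGeometry.Frobenioids.PerfectionEndomorphisms
import HarnessLib

/-!
# Frobenioids I, §3/§5: a level-compatible family of isomorphisms `O^▷(A^{(c)}) ⥲ O^▷(B^{(c)})` induces
# an isomorphism `O^▷((A, n)) ⥲ O^▷((B, m))` in the perfection `C^pf`

Mochizuki, *The geometry of Frobenioids I: the general theory*, Kyushu J. Math. **62** (2008)
293–400, Definition 3.1 (ii)/(iii) pp. 56–57 and Proposition 5.5 (i) p. 104 (proof p. 104 l. 48 – p. 105
l. 1: "the case of arbitrary `A` then follows by considering 'pairs of pre-steps' … [cf. also Definition 1.3,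
(iii), (c)]") [cite: MochizukiFrdI2008, Prop. 5.5 (i) p.104].

Companion of `PerfectionEndomorphisms.lean` (node FrdI:Prop5.5(i), sub-node P55-L02): the inductive-limit
bookkeeping behind the transfer of `O^▷` along pairs of pre-steps.  `O^▷(X) = lim_→ O^▷(X.obj^{(c)})`
(`endSubmonoidClassHom`, `exists_endSubmonoidClassHom_eq`, `endClassHom_eq_iff`); hence a family of
isomorphisms of monoids `g_c : O^▷(X.obj^{(c)}) ⥲ O^▷(Y.obj^{(c)})` COMPATIBLE WITH THE TRANSPORT between levels
(Prop. 1.10 (i), `liftLevel`) induces an isomorphism of monoids `colimEquiv g : O^▷(X) ⥲ O^▷(Y)` characterised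
by `colimEquiv g [θ] = [g_c θ]` (`colimEquiv_class`).  In `PerfectionEndCoAngularTransfer.lean` the family is
the one of Def. 1.3 (iii)(c) along the Frobenius conjugates of a co-angular pre-step.  Pure bookkeeping over
`hF : IsFrobenioid F`; nothing here is specific to abc.
-/

namespace Literature.AlgebraicGeometry.Frobenioids

namespace PreFrobenioid

namespace Perfection

open CategoryTheory Opposite

universe w v v' u u'

variable {D : Type u} [Category.{v} D] {Φ : Dᵒᵖ ⥤ CommMonCat.{w}}
  {C : Type u'} [Category.{v'} C] {F : C ⥤ ElemFrobenioid Φ} {hF : IsFrobenioid F}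
  {X Y : Perfection hF}

/-! ### Transport of elements of `O^▷(A^{(c)})` between levels -/

variable (X) in
/-- The transport `O^▷(X.obj^{(c)}) → O^▷(X.obj^{(c')})` (`c ∣ c'`) of Prop. 1.10 (i), as a map of subtypes.
[cite: MochizukiFrdI2008, Prop. 1.10 (i) p.34] -/
noncomputable def liftEnd {c c' : ℕ+} (h : c ∣ c') (θ : endSubmonoid F (frobPow hF X.obj c)) :
    endSubmonoid F (frobPow hF X.obj c') :=
  ⟨End.of (liftLevel hF (End.asHom θ.1) h h rfl), (liftLevel_mem_iff X h θ.1 rfl).mpr θ.2⟩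

/-- The underlying arrow of `liftEnd`. [cite: MochizukiFrdI2008, Prop. 1.10 (i) p.34] -/
theorem liftEnd_coe {c c' : ℕ+} (h : c ∣ c') (θ : endSubmonoid F (frobPow hF X.obj c)) :
    (liftEnd X h θ).1 = End.of (liftLevel hF (End.asHom θ.1) h h rfl) := rfl

/-- Transport does not change the class in `O^▷(X)`. [cite: MochizukiFrdI2008, Def. 3.1 (ii) p.56] -/
theorem endSubmonoidClassHom_liftEnd {c c' : ℕ+} (h : c ∣ c') (θ : endSubmonoid F (frobPow hF X.obj c)) :
    endSubmonoidClassHom X c' (liftEnd X h θ) = endSubmonoidClassHom X c θ :=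
  endSubmonoidClassHom_liftLevel X h θ rfl

/-- The inductive-limit criterion for `O^▷(X)`: `[θ] = [θ']` iff `θ`, `θ'` have a common transport.
[cite: MochizukiFrdI2008, Def. 3.1 (ii) p.56] -/
theorem endSubmonoidClassHom_eq_iff {c c' : ℕ+} (θ : endSubmonoid F (frobPow hF X.obj c))
    (θ' : endSubmonoid F (frobPow hF X.obj c')) :
    endSubmonoidClassHom X c θ = endSubmonoidClassHom X c' θ' ↔
      ∃ (c'' : ℕ+) (h : c ∣ c'') (h' : c' ∣ c''), liftEnd X h θ = liftEnd X h' θ' := by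
  rw [← Subtype.coe_inj, endSubmonoidClassHom_coe, endSubmonoidClassHom_coe, endClassHom_eq_iff]
  refine exists_congr fun c'' => exists_congr fun h => exists_congr fun h' => ?_
  rw [← Subtype.coe_inj, liftEnd_coe, liftEnd_coe]
  exact Iff.rfl

/-! ### Level-compatible families of isomorphisms -/

variable (g : ∀ c : ℕ+, endSubmonoid F (frobPow hF X.obj c) ≃* endSubmonoid F (frobPow hF Y.obj c))

/-- Compatibility of the family `g` with transport passes to the inverse family.
[cite: MochizukiFrdI2008, Prop. 1.10 (i) p.34] -/
theorem liftEnd_symm_of_liftEnd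
    (hg : ∀ {c c' : ℕ+} (h : c ∣ c') (θ : endSubmonoid F (frobPow hF X.obj c)),
      g c' (liftEnd X h θ) = liftEnd Y h (g c θ))
    {c c' : ℕ+} (h : c ∣ c') (θ : endSubmonoid F (frobPow hF Y.obj c)) :
    (g c').symm (liftEnd Y h θ) = liftEnd X h ((g c).symm θ) := by
  apply (g c').injective
  rw [MulEquiv.apply_symm_apply, hg, MulEquiv.apply_symm_apply]

/-- A chosen level for an element of `O^▷(X)`. [cite: MochizukiFrdI2008, Def. 3.1 (iii) p.57] -/
noncomputable def repLevel (f : (ops hF).endSubmonoid X) : ℕ+ := (exists_endSubmonoidClassHom_eq X f).choose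

/-- A chosen representative of an element of `O^▷(X)` at the level `repLevel f`.
[cite: MochizukiFrdI2008, Def. 3.1 (iii) p.57] -/
noncomputable def repEnd (f : (ops hF).endSubmonoid X) : endSubmonoid F (frobPow hF X.obj (repLevel f)) :=
  (exists_endSubmonoidClassHom_eq X f).choose_spec.choose

/-- The chosen representative represents. [cite: MochizukiFrdI2008, Def. 3.1 (iii) p.57] -/
theorem class_repEnd (f : (ops hF).endSubmonoid X) : endSubmonoidClassHom X (repLevel f) (repEnd f) = f :=
  (exists_endSubmonoidClassHom_eq X f).choose_spec.choose_spec

/-- The map `O^▷(X) → O^▷(Y)` induced by the family `g`: `[θ] ↦ [g θ]` on a chosen representative.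
[cite: MochizukiFrdI2008, Prop. 5.5 (i) p.104] -/
noncomputable def colimMap (f : (ops hF).endSubmonoid X) : (ops hF).endSubmonoid Y :=
  endSubmonoidClassHom Y (repLevel f) (g _ (repEnd f))

/-- `colimMap g [θ] = [g_c θ]` for EVERY representative, when `g` is compatible with transport.
[cite: MochizukiFrdI2008, Prop. 5.5 (i) p.104] -/
theorem colimMap_class
    (hg : ∀ {c c' : ℕ+} (h : c ∣ c') (θ : endSubmonoid F (frobPow hF X.obj c)),
      g c' (liftEnd X h θ) = liftEnd Y h (g c θ))
    (c : ℕ+) (θ : endSubmonoid F (frobPow hF X.obj c)) :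
    colimMap g (endSubmonoidClassHom X c θ) = endSubmonoidClassHom Y c (g c θ) := by
  unfold colimMap
  have e := class_repEnd (endSubmonoidClassHom X c θ)
  obtain ⟨c'', h₁, h, e'⟩ := (endSubmonoidClassHom_eq_iff _ _).mp e
  rw [← endSubmonoidClassHom_liftEnd h₁, ← endSubmonoidClassHom_liftEnd h (g c θ), ← hg, ← hg, e']

/-- `colimMap g` is multiplicative. [cite: MochizukiFrdI2008, Prop. 5.5 (i) p.104] -/
theorem colimMap_mul
    (hg : ∀ {c c' : ℕ+} (h : c ∣ c') (θ : endSubmonoid F (frobPow hF X.obj c)),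
      g c' (liftEnd X h θ) = liftEnd Y h (g c θ))
    (f f' : (ops hF).endSubmonoid X) : colimMap g (f * f') = colimMap g f * colimMap g f' := by
  obtain ⟨c, θ, rfl⟩ := exists_endSubmonoidClassHom_eq X f
  obtain ⟨c', θ', rfl⟩ := exists_endSubmonoidClassHom_eq X f'
  rw [← endSubmonoidClassHom_liftEnd (dvd_mul_right c c') θ, ← endSubmonoidClassHom_liftEnd (dvd_mul_left c' c) θ',
    ← map_mul, colimMap_class g hg, colimMap_class g hg, colimMap_class g hg, map_mul, map_mul]

/-- `colimMap g 1 = 1`. [cite: MochizukiFrdI2008, Prop. 5.5 (i) p.104] -/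
theorem colimMap_one
    (hg : ∀ {c c' : ℕ+} (h : c ∣ c') (θ : endSubmonoid F (frobPow hF X.obj c)),
      g c' (liftEnd X h θ) = liftEnd Y h (g c θ)) :
    colimMap g 1 = 1 := by
  rw [← (endSubmonoidClassHom X 1).map_one, colimMap_class g hg, map_one, map_one]

/-- `colimMap` of the inverse family is a left inverse. [cite: MochizukiFrdI2008, Prop. 5.5 (i) p.104] -/
theorem colimMap_symm_colimMap
    (hg : ∀ {c c' : ℕ+} (h : c ∣ c') (θ : endSubmonoid F (frobPow hF X.obj c)),
      g c' (liftEnd X h θ) = liftEnd Y h (g c θ))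
    (f : (ops hF).endSubmonoid X) : colimMap (fun c => (g c).symm) (colimMap g f) = f := by
  obtain ⟨c, θ, rfl⟩ := exists_endSubmonoidClassHom_eq X f
  rw [colimMap_class g hg, colimMap_class (fun c => (g c).symm) (fun h θ => liftEnd_symm_of_liftEnd g hg h θ),
    MulEquiv.symm_apply_apply]

/-- `colimMap` of the inverse family is a right inverse. [cite: MochizukiFrdI2008, Prop. 5.5 (i) p.104] -/
theorem colimMap_colimMap_symm
    (hg : ∀ {c c' : ℕ+} (h : c ∣ c') (θ : endSubmonoid F (frobPow hF X.obj c)),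
      g c' (liftEnd X h θ) = liftEnd Y h (g c θ))
    (f : (ops hF).endSubmonoid Y) : colimMap g (colimMap (fun c => (g c).symm) f) = f := by
  obtain ⟨c, θ, rfl⟩ := exists_endSubmonoidClassHom_eq Y f
  rw [colimMap_class (fun c => (g c).symm) (fun h θ => liftEnd_symm_of_liftEnd g hg h θ), colimMap_class g hg,
    MulEquiv.apply_symm_apply]

/-- **A level-compatible family of isomorphisms `O^▷(X.obj^{(c)}) ⥲ O^▷(Y.obj^{(c)})` induces an isomorphism
`O^▷(X) ⥲ O^▷(Y)`** (passage to the inductive limit). [cite: MochizukiFrdI2008, Prop. 5.5 (i) p.104] -/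
noncomputable def colimEquiv
    (hg : ∀ {c c' : ℕ+} (h : c ∣ c') (θ : endSubmonoid F (frobPow hF X.obj c)),
      g c' (liftEnd X h θ) = liftEnd Y h (g c θ)) :
    (ops hF).endSubmonoid X ≃* (ops hF).endSubmonoid Y where
  toFun := colimMap g
  invFun := colimMap fun c => (g c).symm
  left_inv := colimMap_symm_colimMap g hg
  right_inv := colimMap_colimMap_symm g hg
  map_mul' := colimMap_mul g hg

/-- `colimEquiv g [θ] = [g_c θ]`. [cite: MochizukiFrdI2008, Prop. 5.5 (i) p.104] -/
theorem colimEquiv_class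
    (hg : ∀ {c c' : ℕ+} (h : c ∣ c') (θ : endSubmonoid F (frobPow hF X.obj c)),
      g c' (liftEnd X h θ) = liftEnd Y h (g c θ))
    (c : ℕ+) (θ : endSubmonoid F (frobPow hF X.obj c)) :
    colimEquiv g hg (endSubmonoidClassHom X c θ) = endSubmonoidClassHom Y c (g c θ) :=
  colimMap_class g hg c θ

/-- `(colimEquiv g).symm [θ] = [g_c⁻¹ θ]`. [cite: MochizukiFrdI2008, Prop. 5.5 (i) p.104] -/
theorem colimEquiv_symm_class
    (hg : ∀ {c c' : ℕ+} (h : c ∣ c') (θ : endSubmonoid F (frobPow hF X.obj c)),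
      g c' (liftEnd X h θ) = liftEnd Y h (g c θ))
    (c : ℕ+) (θ : endSubmonoid F (frobPow hF Y.obj c)) :
    (colimEquiv g hg).symm (endSubmonoidClassHom Y c θ) = endSubmonoidClassHom X c ((g c).symm θ) :=
  colimMap_class (fun c => (g c).symm) (fun h θ => liftEnd_symm_of_liftEnd g hg h θ) c θ

end Perfection

end PreFrobenioid

end Literature.AlgebraicGeometry.Frobenioids
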